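import Literature.Computability.AlgebraicComplexity.RealTauKnownCases
import Summits.ValiantsHypothesis.ValiantsHypothesis.Theorems.LacunarySymmetroidMatrixDescartesCensusDefiniteMiddlePastTypeK3

/-!
# `MatrixDescartes` census — DOOR A, interior-definite-letter programme at `(2,3)`: the WALK TOOLKIT
# (2×2 definiteness from `det` and a diagonal sign, compressions are trinomials, end behaviour, endpoint continuity)

HONEST FRAMING.  Object-search cell `pub-symmetroid`, door-A seat `val-sym-door-p4` (gen 15); items stmt-ValiantsHypothesis-19979
`DoorA26` / 19980 `DoorA34` (OPEN, typed, never asserted); helper `--supports 19979`, NO closure claim.  Elementary tools for the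
assembly of IDL(3) (`…CensusDefiniteMiddleK3Law`); nothing here bounds a root count of interest by itself, decides
`DoorA26`/`DoorA34`, or bears on `MatrixDescartes` (stmt-ValiantsHypothesis-18050) / `VP ≠ VNP`.

* `quadform_eq`, `mul_quadform_pos_of_det_pos` — a real symmetric `2 × 2` matrix with `det > 0` is definite, of the sign of its
  `(0,0)` entry; `det_pos_of_definite` — a definite one has `det > 0`; `exists_quadform_pos_of_det_neg` /
  `exists_quadform_neg_of_det_neg` — one with `det < 0` takes both signs;
* `quadform_pencil`, `comp_three_sign_changes` — the compression `x ↦ vᵀ(S₀ + x^d·1 + x^e·S₂)v` is the trinomial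
  `vᵀS₀v + |v|²x^d + vᵀS₂v·x^e` and cannot change sign three times along four increasing positive points;
* `nonneg_of_pos_on_right`, `nonneg_of_pos_on_left` — endpoint continuity; `eventually_pos_of_dominant` — a dominant top
  monomial decides the sign at `+∞`.

[folklore] Elementary real analysis and `2 × 2` algebra; the trinomial root bound is the tree's
`Literature.Computability.AlgebraicComplexity.card_roots_toFinset_filter_pos_lt_card_support`.  Axioms standard; no definitions.
-/

-- the D-0017 layout repeats a namespace component (single-conjunct summit); the `dupNamespace` linter flags it; name mandated.
set_option linter.dupNamespace false

namespace Summit.ValiantsHypothesis.ValiantsHypothesis.Theorems.LacunarySymmetroidMatrixDescartes.Census.DefiniteMiddle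

open Real Matrix Finset Polynomial
open scoped BigOperators

/-! ## §1 Quadratic forms of real symmetric `2 × 2` matrices -/

/-- The quadratic form of a `2 × 2` matrix with equal off-diagonal entries. [folklore] -/
theorem quadform_eq (M : Matrix (Fin 2) (Fin 2) ℝ) (hM : M 1 0 = M 0 1) (v : Fin 2 → ℝ) :
    v ⬝ᵥ (M *ᵥ v) = M 0 0 * v 0 ^ 2 + 2 * M 0 1 * v 0 * v 1 + M 1 1 * v 1 ^ 2 := by
  simp only [Matrix.mulVec, dotProduct, Fin.sum_univ_two, hM]
  ring

/-- A vector of `Fin 2 → ℝ` with both coordinates zero is zero. [folklore] -/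
theorem vec2_eq_zero {v : Fin 2 → ℝ} (h0 : v 0 = 0) (h1 : v 1 = 0) : v = 0 := by
  funext i; fin_cases i <;> simp [h0, h1]

/-- **`det > 0` ⇒ definite of the sign of the `(0,0)` entry**: `0 < M₀₀ · vᵀMv` for `v ≠ 0`. [folklore] -/
theorem mul_quadform_pos_of_det_pos (M : Matrix (Fin 2) (Fin 2) ℝ) (hM : M 1 0 = M 0 1)
    (hdet : 0 < M 0 0 * M 1 1 - M 0 1 ^ 2) (v : Fin 2 → ℝ) (hv : v ≠ 0) : 0 < M 0 0 * (v ⬝ᵥ (M *ᵥ v)) := by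
  rw [quadform_eq M hM]
  have h00 : M 0 0 ≠ 0 := by
    intro h; rw [h, zero_mul] at hdet; nlinarith [sq_nonneg (M 0 1)]
  have key : M 0 0 * (M 0 0 * v 0 ^ 2 + 2 * M 0 1 * v 0 * v 1 + M 1 1 * v 1 ^ 2)
      = (M 0 0 * v 0 + M 0 1 * v 1) ^ 2 + (M 0 0 * M 1 1 - M 0 1 ^ 2) * v 1 ^ 2 := by ring
  rw [key]
  rcases eq_or_ne (v 1) 0 with h1 | h1
  · have h0 : v 0 ≠ 0 := fun h0 => hv (vec2_eq_zero h0 h1)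
    have hne : M 0 0 * v 0 ≠ 0 := mul_ne_zero h00 h0
    have : 0 < (M 0 0 * v 0) ^ 2 := by positivity
    rw [h1]
    nlinarith [this]
  · have : 0 < (M 0 0 * M 1 1 - M 0 1 ^ 2) * v 1 ^ 2 := mul_pos hdet (by positivity)
    nlinarith [sq_nonneg (M 0 0 * v 0 + M 0 1 * v 1)]

/-- **Definite ⇒ `det > 0`** (`2 × 2`, equal off-diagonal entries): if `T · vᵀMv > 0` for all `v ≠ 0` then
`M₀₀M₁₁ − M₀₁² > 0`. [folklore] -/
theorem det_pos_of_definite (M : Matrix (Fin 2) (Fin 2) ℝ) (hM : M 1 0 = M 0 1) (T : ℝ)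
    (hdef : ∀ v : Fin 2 → ℝ, v ≠ 0 → 0 < T * (v ⬝ᵥ (M *ᵥ v))) : 0 < M 0 0 * M 1 1 - M 0 1 ^ 2 := by
  have h1 := hdef ![1, 0] (by intro h; have := congrFun h 0; simp at this)
  rw [quadform_eq M hM] at h1
  simp only [Matrix.cons_val_zero, Matrix.cons_val_one] at h1
  have h00 : 0 < T * M 0 0 := by nlinarith
  have hne : M 0 0 ≠ 0 := by rintro h; rw [h] at h00; simp at h00
  have h2 := hdef ![M 0 1, -M 0 0] (by intro h; have := congrFun h 1; simp [hne] at this)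
  rw [quadform_eq M hM] at h2
  simp only [Matrix.cons_val_zero, Matrix.cons_val_one] at h2
  have e : M 0 0 * M 0 1 ^ 2 + 2 * M 0 1 * M 0 1 * -M 0 0 + M 1 1 * (-M 0 0) ^ 2
      = M 0 0 * (M 0 0 * M 1 1 - M 0 1 ^ 2) := by ring
  rw [e, ← mul_assoc] at h2
  exact pos_of_mul_pos_right h2 h00.le

/-- **`det < 0` ⇒ the form takes a positive value.** [folklore] -/
theorem exists_quadform_pos_of_det_neg (M : Matrix (Fin 2) (Fin 2) ℝ) (hM : M 1 0 = M 0 1)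
    (hdet : M 0 0 * M 1 1 - M 0 1 ^ 2 < 0) : ∃ v : Fin 2 → ℝ, 0 < v ⬝ᵥ (M *ᵥ v) := by
  by_cases h00 : 0 < M 0 0
  · refine ⟨![1, 0], ?_⟩
    rw [quadform_eq M hM]; simp; exact h00
  by_cases h11 : 0 < M 1 1
  · refine ⟨![0, 1], ?_⟩
    rw [quadform_eq M hM]; simp; exact h11
  rw [not_lt] at h00 h11
  rcases lt_or_eq_of_le h00 with hlt | heq
  · refine ⟨![M 0 1, -M 0 0], ?_⟩
    rw [quadform_eq M hM]
    simp only [Matrix.cons_val_zero, Matrix.cons_val_one]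
    have e : M 0 0 * M 0 1 ^ 2 + 2 * M 0 1 * M 0 1 * -M 0 0 + M 1 1 * (-M 0 0) ^ 2
        = M 0 0 * (M 0 0 * M 1 1 - M 0 1 ^ 2) := by ring
    rw [e]; exact mul_pos_of_neg_of_neg hlt hdet
  · -- `M₀₀ = 0`, so `M₀₁ ≠ 0`; take `v = (1, s·M₀₁)` with `s = 1/(1 + |M₁₁|)`
    have h01 : M 0 1 ≠ 0 := by intro h; rw [heq, h] at hdet; simp at hdet
    set s : ℝ := 1 / (1 + |M 1 1|) with hs
    have hspos : 0 < s := by rw [hs]; positivity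
    refine ⟨![1, s * M 0 1], ?_⟩
    rw [quadform_eq M hM]
    simp only [Matrix.cons_val_zero, Matrix.cons_val_one, heq]
    have e : 0 * 1 ^ 2 + 2 * M 0 1 * 1 * (s * M 0 1) + M 1 1 * (s * M 0 1) ^ 2
        = s * M 0 1 ^ 2 * (2 + M 1 1 * s) := by ring
    rw [e]
    have hsq : 0 < M 0 1 ^ 2 := by positivity
    have h3 : 0 < 2 + M 1 1 * s := by
      have hle : |M 1 1 * s| ≤ 1 := by
        rw [abs_mul, abs_of_pos hspos, hs]
        rw [← mul_div_assoc, mul_one, div_le_one (by positivity)]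
        linarith [abs_nonneg (M 1 1)]
      have := neg_abs_le (M 1 1 * s)
      linarith
    positivity

/-- **`det < 0` ⇒ the form takes a negative value.** [folklore] -/
theorem exists_quadform_neg_of_det_neg (M : Matrix (Fin 2) (Fin 2) ℝ) (hM : M 1 0 = M 0 1)
    (hdet : M 0 0 * M 1 1 - M 0 1 ^ 2 < 0) : ∃ v : Fin 2 → ℝ, v ⬝ᵥ (M *ᵥ v) < 0 := by
  obtain ⟨v, hv⟩ := exists_quadform_pos_of_det_neg (-M) (by simp [hM]) (by simp; linarith)
  refine ⟨v, ?_⟩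
  rw [Matrix.neg_mulVec, dotProduct_neg] at hv
  linarith

/-- For any sign `T ≠ 0`: `det < 0` ⇒ the form takes a value with `T · vᵀMv < 0`. [folklore] -/
theorem exists_mul_quadform_neg_of_det_neg (M : Matrix (Fin 2) (Fin 2) ℝ) (hM : M 1 0 = M 0 1)
    (hdet : M 0 0 * M 1 1 - M 0 1 ^ 2 < 0) (T : ℝ) (hT : T = 1 ∨ T = -1) :
    ∃ v : Fin 2 → ℝ, T * (v ⬝ᵥ (M *ᵥ v)) < 0 := by
  rcases hT with rfl | rfl
  · obtain ⟨v, hv⟩ := exists_quadform_neg_of_det_neg M hM hdet; exact ⟨v, by linarith⟩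
  · obtain ⟨v, hv⟩ := exists_quadform_pos_of_det_neg M hM hdet; exact ⟨v, by linarith⟩

/-! ## §2 Compressions of the pencil `S₀ + x^d·1 + x^e·S₂` are trinomials -/

/-- The compression of the pencil along `v`: `vᵀ(S₀ + x^d·1 + x^e·S₂)v = vᵀS₀v + (v·v)x^d + (vᵀS₂v)x^e`. [folklore] -/
theorem quadform_pencil (S₀ S₂ : Matrix (Fin 2) (Fin 2) ℝ) (d e : ℕ) (x : ℝ) (v : Fin 2 → ℝ) :
    v ⬝ᵥ ((S₀ + x ^ d • (1 : Matrix (Fin 2) (Fin 2) ℝ) + x ^ e • S₂) *ᵥ v)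
      = v ⬝ᵥ (S₀ *ᵥ v) + (v ⬝ᵥ v) * x ^ d + (v ⬝ᵥ (S₂ *ᵥ v)) * x ^ e := by
  simp only [Matrix.add_mulVec, Matrix.smul_mulVec, Matrix.one_mulVec, dotProduct_add, dotProduct_smul,
    smul_eq_mul]
  ring

/-- A trinomial `C a + C b·X^d + C c·X^e` has at most three monomials. [folklore] -/
theorem card_support_trinomial_le (a b c : ℝ) (d e : ℕ) :
    (C a + C b * X ^ d + C c * X ^ e : ℝ[X]).support.card ≤ 3 := by
  have hsub : (C a + C b * X ^ d + C c * X ^ e : ℝ[X]).support ⊆ {0, d, e} := by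
    intro k hk
    rw [mem_support_iff] at hk
    by_contra hk'
    simp only [Finset.mem_insert, Finset.mem_singleton, not_or] at hk'
    apply hk
    simp only [coeff_add, coeff_C, coeff_C_mul_X_pow, hk'.1, hk'.2.1, hk'.2.2, if_false, add_zero]
  exact (Finset.card_le_card hsub).trans Finset.card_le_three

/-- **A compression cannot change sign three times.**  For points `0 < m₁ < m₂ < m₃ < m₄` and a sign `T` the values
`T·vᵀF(mᵢ)v` of the compression of `F(x) = S₀ + x^d·1 + x^e·S₂` cannot be `> 0, < 0, > 0, < 0`: three sign changes would
give three positive roots of the nonzero trinomial `vᵀS₀v + (v·v)x^d + (vᵀS₂v)x^e`. [folklore] -/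
theorem comp_three_sign_changes (S₀ S₂ : Matrix (Fin 2) (Fin 2) ℝ) (d e : ℕ) (v : Fin 2 → ℝ) (T : ℝ)
    {m₁ m₂ m₃ m₄ : ℝ} (h0 : 0 < m₁) (h12 : m₁ < m₂) (h23 : m₂ < m₃) (h34 : m₃ < m₄)
    (s1 : 0 < T * (v ⬝ᵥ ((S₀ + m₁ ^ d • (1 : Matrix (Fin 2) (Fin 2) ℝ) + m₁ ^ e • S₂) *ᵥ v)))
    (s2 : T * (v ⬝ᵥ ((S₀ + m₂ ^ d • (1 : Matrix (Fin 2) (Fin 2) ℝ) + m₂ ^ e • S₂) *ᵥ v)) < 0)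
    (s3 : 0 < T * (v ⬝ᵥ ((S₀ + m₃ ^ d • (1 : Matrix (Fin 2) (Fin 2) ℝ) + m₃ ^ e • S₂) *ᵥ v)))
    (s4 : T * (v ⬝ᵥ ((S₀ + m₄ ^ d • (1 : Matrix (Fin 2) (Fin 2) ℝ) + m₄ ^ e • S₂) *ᵥ v)) < 0) : False := by
  classical
  set G : ℝ[X] := C (v ⬝ᵥ (S₀ *ᵥ v)) + C (v ⬝ᵥ v) * X ^ d + C (v ⬝ᵥ (S₂ *ᵥ v)) * X ^ e with hG
  have hev : ∀ x : ℝ, T * (v ⬝ᵥ ((S₀ + x ^ d • (1 : Matrix (Fin 2) (Fin 2) ℝ) + x ^ e • S₂) *ᵥ v))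
      = T * G.eval x := by
    intro x; rw [quadform_pencil, hG]; simp [eval_add, eval_mul, eval_C, eval_pow, eval_X]
  rw [hev] at s1 s2 s3 s4
  have hcont : Continuous fun x => T * G.eval x := continuous_const.mul G.continuous
  have hT : T ≠ 0 := by rintro rfl; simp at s1
  -- three roots by the intermediate value theorem
  obtain ⟨ρ₁, ⟨h1l, h1r⟩, hρ₁⟩ := intermediate_value_Ioo' h12.le hcont.continuousOn ⟨s2, s1⟩
  obtain ⟨ρ₂, ⟨h2l, h2r⟩, hρ₂⟩ := intermediate_value_Ioo h23.le hcont.continuousOn ⟨s2, s3⟩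
  obtain ⟨ρ₃, ⟨h3l, h3r⟩, hρ₃⟩ := intermediate_value_Ioo' h34.le hcont.continuousOn ⟨s4, s3⟩
  simp only [mul_eq_zero, hT, false_or] at hρ₁ hρ₂ hρ₃
  have hG0 : G ≠ 0 := by rintro h; rw [h, eval_zero, mul_zero] at s1; exact lt_irrefl 0 s1
  have hmem : ∀ ρ, 0 < ρ → G.eval ρ = 0 → ρ ∈ G.roots.toFinset.filter (fun x => 0 < x) := by
    intro ρ hρ h
    exact Finset.mem_filter.mpr ⟨Multiset.mem_toFinset.mpr ((mem_roots hG0).mpr h), hρ⟩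
  have h3 : ({ρ₁, ρ₂, ρ₃} : Finset ℝ) ⊆ G.roots.toFinset.filter (fun x => 0 < x) := by
    intro ρ hρ
    simp only [Finset.mem_insert, Finset.mem_singleton] at hρ
    rcases hρ with rfl | rfl | rfl
    · exact hmem _ (lt_trans h0 h1l) hρ₁
    · exact hmem _ (by linarith) hρ₂
    · exact hmem _ (by linarith) hρ₃
  have hcard3 : ({ρ₁, ρ₂, ρ₃} : Finset ℝ).card = 3 := by
    rw [Finset.card_insert_of_notMem, Finset.card_insert_of_notMem, Finset.card_singleton]
    · simp only [Finset.mem_singleton]; exact ne_of_lt (by linarith)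
    · simp only [Finset.mem_insert, Finset.mem_singleton, not_or]
      exact ⟨ne_of_lt (by linarith), ne_of_lt (by linarith)⟩
  have hle := Finset.card_le_card h3
  have hlt := Literature.Computability.AlgebraicComplexity.card_roots_toFinset_filter_pos_lt_card_support hG0
  have hsupp := card_support_trinomial_le (v ⬝ᵥ (S₀ *ᵥ v)) (v ⬝ᵥ v) (v ⬝ᵥ (S₂ *ᵥ v)) d e
  rw [← hG] at hsupp
  omega

/-! ## §3 Endpoint continuity and the sign at `+∞` -/

/-- A function continuous at `a` and positive on `(a,b)` (`a < b`) is `≥ 0` at `a`. [folklore] -/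
theorem nonneg_of_pos_on_right {f : ℝ → ℝ} {a b : ℝ} (hab : a < b) (hf : ContinuousAt f a)
    (hpos : ∀ x, a < x → x < b → 0 < f x) : 0 ≤ f a := by
  by_contra hneg
  rw [not_le] at hneg
  have hev : ∀ᶠ x in nhds a, f x < 0 := hf.eventually (Iio_mem_nhds hneg)
  obtain ⟨ε, hε, hball⟩ := Metric.eventually_nhds_iff.mp hev
  set x := a + min (ε / 2) ((b - a) / 2) with hx
  have hmin1 : min (ε / 2) ((b - a) / 2) ≤ ε / 2 := min_le_left _ _
  have hmin2 : min (ε / 2) ((b - a) / 2) ≤ (b - a) / 2 := min_le_right _ _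
  have hminpos : 0 < min (ε / 2) ((b - a) / 2) := lt_min (by linarith) (by linarith)
  have h1 : a < x := by rw [hx]; linarith
  have h2 : x < b := by rw [hx]; linarith
  have h3 : dist x a < ε := by
    rw [Real.dist_eq, abs_of_pos (by linarith)]; rw [hx]; linarith
  linarith [hball h3, hpos x h1 h2]

/-- A function continuous at `b` and positive on `(a,b)` (`a < b`) is `≥ 0` at `b`. [folklore] -/
theorem nonneg_of_pos_on_left {f : ℝ → ℝ} {a b : ℝ} (hab : a < b) (hf : ContinuousAt f b)
    (hpos : ∀ x, a < x → x < b → 0 < f x) : 0 ≤ f b := by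
  have hf' : ContinuousAt (fun x => f (-x)) (-b) := by
    have : ContinuousAt f (-(-b)) := by rw [neg_neg]; exact hf
    exact this.comp (continuous_neg.continuousAt)
  have := nonneg_of_pos_on_right (f := fun x => f (-x)) (neg_lt_neg hab) hf'
    (fun x h1 h2 => hpos (-x) (by linarith) (by linarith))
  simpa using this

/-- **A dominant top monomial decides the sign at `+∞`.**  If `|L(x)| ≤ K·x^n` for `x ≥ 1` and `c > 0` then
`L(x) + c·x^(n+1) > 0` for `x ≥ max 1 (K/c + 1)`. [folklore] -/
theorem eventually_pos_of_dominant {L : ℝ → ℝ} {K c : ℝ} {n : ℕ} (hc : 0 < c)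
    (hL : ∀ x : ℝ, 1 ≤ x → |L x| ≤ K * x ^ n) (x : ℝ) (hx : max 1 (K / c + 1) ≤ x) :
    0 < L x + c * x ^ (n + 1) := by
  have hx1 : 1 ≤ x := le_trans (le_max_left _ _) hx
  have hx2 : K / c + 1 ≤ x := le_trans (le_max_right _ _) hx
  have hxn : 0 < x ^ n := by positivity
  have hKc : K < c * x := by
    have : K / c < x := by linarith
    calc K = c * (K / c) := by field_simp
      _ < c * x := mul_lt_mul_of_pos_left this hc
  have h1 := hL x hx1
  have h2 : -(K * x ^ n) ≤ L x := by have := neg_abs_le (L x); linarith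
  calc (0:ℝ) < (c * x - K) * x ^ n := mul_pos (by linarith) hxn
    _ = -(K * x ^ n) + c * x ^ (n + 1) := by ring
    _ ≤ L x + c * x ^ (n + 1) := by linarith

/-- Monomial bound on `[1,∞)`: `|a·x^k| ≤ |a|·x^n` for `k ≤ n`, `x ≥ 1`. [folklore] -/
theorem abs_mul_pow_le {a x : ℝ} {k n : ℕ} (hx : 1 ≤ x) (hkn : k ≤ n) : |a * x ^ k| ≤ |a| * x ^ n := by
  rw [abs_mul, abs_of_nonneg (by positivity : (0:ℝ) ≤ x ^ k)]
  exact mul_le_mul_of_nonneg_left (pow_le_pow_right₀ hx hkn) (abs_nonneg a)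

end Summit.ValiantsHypothesis.ValiantsHypothesis.Theorems.LacunarySymmetroidMatrixDescartes.Census.DefiniteMiddle
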